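import Summits.BirchSwinnertonDyer.BirchSwinnertonDyer.Theorems.SemiOrdinaryEisensteinDescentCasselsTateLemma615OfPoitouTateAt
import Summits.BirchSwinnertonDyer.BirchSwinnertonDyer.Theorems.SemiOrdinaryEisensteinDescentCasselsTateOfShaTwoCochain
import Summits.BirchSwinnertonDyer.BirchSwinnertonDyer.Theorems.SchneiderFreeAdditiveX3PoitouTateReciprocitySumHolds
import Literature.NumberTheory.GaloisCohomology.ArchimedeanInvariantMap
import Literature.NumberTheory.EllipticCurves.ArchimedeanKummerImageMaximal
import HarnessLib

/-!
# Milne I Lemma 6.15 for THE canonical invariant maps at EVERY level — the input `h615` of the tree's Cassels–Tate recipe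
# `isLevelPairing_ctLevelPairing_of_inputs` DISCHARGED at the `2`-power levels too (any number field, any curve)

Route `GenusKolyvaginAtTwo`, crux `KolyvaginExactAtTwo` (stmt-BirchSwinnertonDyer-22137) → Q3-inner, Cassels–Tate block at
the EVEN level; seat `bsd-line-gk2-p2` g13 (cell `bsd-f1-sign2`), `--supports 22137`, helper. THEOREMS ONLY (no definition,
no named fact, no `sorry`, no instance).

The level-pairing property `hB₁`/`hB₂` of the LINE 6/13 capstones (`IsLevelPairing (2^L) (ctLevelPairing W (2^L) e …
(LocalInvariants.canonical ℚ (2^L·2^L)) …)`) is, by the tree's `isLevelPairing_ctLevelPairing_of_inputs`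
(`CasselsTateFiniteSupport.lean`), the conjunction of three inputs: `hPTc` (Milne I Thm. 4.10 (a) for `Ш²(K, E[m])` in cochain
form), `h615` (the conclusion of Milne I Lemma 6.15 for THE maps) and `hct_alt` (Cassels' alternation — LEAD gk2-p1's lane).
Cell `bsd-wall`'s SOED width seats discharged `h615` at the ODD prime-power levels
(`CasselsTateLemma615OfPT.lemma615Input_canonical_of_selmerComplementAt`, p ≠ 2), using oddness at exactly two places:
(a) `H¹(K_w, E[m]) = 0` at the infinite places for odd `m`, so Milne's test classes are Selmer there for free;
(b) the bridge `inv^{(m²)}_v(a ∪_desc b) = m · inv^{(m)}_v(a ∪_{e_D} b)` (`descLocalPairing_canonical_eq`) was proved at the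
finite places and extended to the infinite ones by (a).
Neither use is needed:

* §1 `archimedeanInvariantMap_cohomologyMap_muInclHom_local` — LEVEL CHANGE OF THE ARCHIMEDEAN INVARIANT MAP ON LOCAL CLASSES
  along `μ_n ⊆ μ_N` restricted to `Γ_{K_w}`: `inv_w^{(N)}(ι_* c) = (N/n) · inv_w^{(n)}(c)` for `c ∈ H²(K_w, μ_n)` (the diagonal
  `c(σ,σ) + c(1,1) ∈ μ_n[2]` goes to `μ_N[2]`: `n/2 ↦ N/2`; Serre XIII §3, the case `ℝ`; twin of the tree's
  `archimedeanInvariantMap_localization_cohomologyMap_muInclHom`, which treats localised GLOBAL classes);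
* §2 `descLocalPairing_canonical_inl`, `descLocalPairing_canonical_place` — the bridge (b) at the INFINITE places, hence at
  every place, for EVERY level `m` (covariant naturality of the cup product + §1);
* §3 `lemma615Input_canonical_of_selmerComplementAt_anyLevel` — the SOED theorem WITHOUT `p ≠ 2`: the test classes are
  Selmer at a real place by the injectivity of THE archimedean invariant map there (`canonical_injectiveAtRealPlaces`, the
  clause tp2-p3-w3's `exists_mem_kummerOutside_localization_sub_mem_of_selmerComplementAt` already carries) and vanish at a
  complex place; **`lemma615Input_canonical`** — the `h615` body for `LocalInvariants.canonical K (p^k · p^k)`, EVERY prime `p`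
  (so `p = 2`), every `k ≥ 1`, every number field `K`, every elliptic `E/K`, every finite `S`, UNCONDITIONALLY: Howard's
  complement property of THE maps at every level is the tree theorem `selmerComplement_canonical_holds` (cell bsd-schneider).

So of the three inputs of `hB₁`/`hB₂` at the even level, `h615` is now a theorem; `hct_alt` is LEAD's lane; `hPTc` remains.
BSD is not proved by any of this.

References: [MilneADT2006] I Ex. 1.6 (c), Cor. 2.3, Thm. 2.13, Thm. 4.10 (b), §6 proof of Prop. 6.9, Lemma 6.15;
[SerreLocalFields1979] XIII §3 Cor. 3 and Remarque; [Howard2004HeegnerKolyvagin] Thm. 2.1.11; [GreenbergLNM1716] §4 App. Prop. 4.13.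
-/

noncomputable section

open scoped Classical

-- the Theorems namespace of this sub repeats the summit name by design (D-0017 nested layout)
set_option linter.dupNamespace false
set_option autoImplicit false

open CategoryTheory Field NumberField IsDedekindDomain Function
open _root_.ContinuousCohomology
open Literature.NumberTheory.EllipticCurves Literature.NumberTheory.GaloisCohomology
  Literature.NumberTheory.GaloisRepresentations
open Literature.NumberTheory.GaloisRepresentations.DiscreteGaloisModule (mu MuCarrier SelmerStructure unramifiedSubgroup
  localTatePairingZMod tateDual)
open _root_.WeierstrassCurve
open Summit.BirchSwinnertonDyer.Rank1Residual.X11b.Relaxation (invWeilPairing invWeilPairing_apply)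
open Summit.BirchSwinnertonDyer.BirchSwinnertonDyer.Theorems.CasselsTateLemma615OfPT

namespace Summit.BirchSwinnertonDyer.BirchSwinnertonDyer.Theorems.GenusExact.CasselsTateAnyLevel

/-! ## §0 The element of order two of `ℤ/n` -/

/-- The only non-zero element of `ℤ/n` killed by `2` is `n/2` (and then `n` is even). [folklore] -/
private theorem zmod_eq_natCast_div_two {n : ℕ} [NeZero n] (x : ZMod n) (h2 : 2 • x = 0) (h0 : x ≠ 0) :
    x = ((n / 2 : ℕ) : ZMod n) ∧ 2 ∣ n := by
  have hlt : x.val < n := ZMod.val_lt x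
  have hpos : 0 < x.val := Nat.pos_of_ne_zero fun h => h0 ((ZMod.val_eq_zero x).mp h)
  have h2' : ((2 * x.val : ℕ) : ZMod n) = 0 := by
    rw [two_mul, Nat.cast_add, ZMod.natCast_zmod_val, ← two_nsmul]
    exact h2
  obtain ⟨k, hk⟩ := (ZMod.natCast_eq_zero_iff _ _).mp h2'
  have hk1 : k = 1 := by
    rcases Nat.lt_or_ge k 2 with hk2 | hk2
    · interval_cases k
      · omega
      · rfl
    · have : n * 2 ≤ n * k := Nat.mul_le_mul_left n hk2
      omega
  subst hk1
  rw [mul_one] at hk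
  refine ⟨?_, ⟨x.val, by omega⟩⟩
  have hv : x.val = n / 2 := by omega
  rw [← hv, ZMod.natCast_zmod_val]

/-- An additive isomorphism onto `ℤ/n` sends a non-zero element killed by `2` to `n/2` (and `n` is even). [folklore] -/
private theorem addEquiv_apply_eq_natCast_div_two {A : Type*} [AddCommGroup A] {n : ℕ} [NeZero n]
    (e : A ≃+ ZMod n) {a : A} (h2 : 2 • a = 0) (h0 : a ≠ 0) : e a = ((n / 2 : ℕ) : ZMod n) ∧ 2 ∣ n :=
  zmod_eq_natCast_div_two (e a) (by rw [← map_nsmul, h2, map_zero]) (by rw [ne_eq, e.map_eq_zero_iff]; exact h0)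

/-- `(n/2)·(N/n) = N/2` for `n` even dividing `N`. [folklore] -/
private theorem div_two_mul_div {n N : ℕ} (hn : n ≠ 0) (h2 : 2 ∣ n) (hN : n ∣ N) : n / 2 * (N / n) = N / 2 := by
  obtain ⟨a, rfl⟩ := h2
  obtain ⟨k, rfl⟩ := hN
  rw [Nat.mul_div_cancel_left a two_pos, Nat.mul_div_cancel_left k (Nat.pos_of_ne_zero hn), mul_assoc,
    Nat.mul_div_cancel_left (a * k) two_pos]

/-! ## §1 Level change of the archimedean invariant map on LOCAL classes -/

section ArchLevel

variable {K : Type} [Field K] [NumberField K] {n N : ℕ} [NeZero n] [NeZero N] (w : InfinitePlace K)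

/-- **Level change for `inv_w` on LOCAL classes along `μₙ ⊆ μ_N`** (infinite place `w`, `n ∣ N`): for
`c ∈ H²(K_w, μₙ)` and `ι` the inclusion `μₙ ⊆ μ_N` restricted to `Γ_{K_w}`,
`inv_w^{(N)}(ι_* c) = (N/n) · inv_w^{(n)}(c)` read in `ℤ/N` — the diagonal `c(σ, σ) + c(1, 1) ∈ μₙ[2]` is sent into `μ_N[2]`,
`-1 ↦ -1`, i.e. `n/2 ↦ N/2 = (N/n)·(n/2)`; at a complex place both sides vanish.
[cite: SerreLocalFields1979, XIII §3 Cor. 3] [cite: MilneADT2006, Ch. I, Ex. 1.6 (c)] -/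
theorem archimedeanInvariantMap_cohomologyMap_muInclHom_local (hnN : n ∣ N)
    (c : haveI : CompactSpace (absoluteGaloisGroup (Place.Completion (K := K) (Sum.inl w))) :=
        absoluteGaloisGroup_compactSpace _
      galoisCohomology ((mu K n).toLocal (Sum.inl w)) 2) :
    haveI : CompactSpace (absoluteGaloisGroup K) := absoluteGaloisGroup_compactSpace K
    haveI : CompactSpace (absoluteGaloisGroup (Place.Completion (K := K) (Sum.inl w))) :=
      absoluteGaloisGroup_compactSpace _
    archimedeanInvariantMap K N w (cohomologyMap (TopRep.ofHom ((muInclHom K hnN).hom.restrict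
        (absGaloisRestrict K (Place.Completion (Sum.inl w : Place K)) :
          absoluteGaloisGroup (Place.Completion (Sum.inl w : Place K)) →* absoluteGaloisGroup K)) :
        ((mu K n).toLocal (Sum.inl w : Place K)).toTopRep ⟶ ((mu K N).toLocal (Sum.inl w : Place K)).toTopRep) 2 c) =
      (((archimedeanInvariantMap K n w c).val * (N / n) : ℕ) : ZMod N) := by
  haveI : CompactSpace (absoluteGaloisGroup K) := absoluteGaloisGroup_compactSpace K
  haveI : CompactSpace (absoluteGaloisGroup (Place.Completion (K := K) (Sum.inl w))) :=
    absoluteGaloisGroup_compactSpace _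
  rcases w.isReal_or_isComplex with hw | hw
  swap
  · -- complex place: both sides vanish
    rw [archimedeanInvariantMap_eq_zero_of_isComplex hw, archimedeanInvariantMap_eq_zero_of_isComplex hw,
      ZMod.val_zero, zero_mul, Nat.cast_zero]
  haveI := finite_absoluteGaloisGroup_placeCompletion_inl K w
  have hG := natCard_absoluteGaloisGroup_placeCompletion_inl_le_two K w
  obtain ⟨σ, hσ⟩ := exists_ne_one_absoluteGaloisGroup_of_isReal (K := K) hw
  obtain ⟨φ, rfl⟩ := twoCocycleClass_surjective ((mu K n).toLocal (Sum.inl w : Place K)).toTopRep c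
  rw [cohomologyMap_twoCocycleClass, archimedeanInvariantMap_twoCocycleClass, archimedeanInvariantMap_twoCocycleClass,
    twoCocycleDiagonal_of_ne_one (X := ((mu K N).toLocal (Sum.inl w : Place K)).toTopRep) hG hσ,
    twoCocycleDiagonal_of_ne_one (X := ((mu K n).toLocal (Sum.inl w : Place K)).toTopRep) hG hσ,
    pullback₂_id_resIdHom_apply, pullback₂_id_resIdHom_apply]
  change muCarrierZModEquiv K N (muInclusion K hnN (φ.1 (σ, σ)) + muInclusion K hnN (φ.1 (1, 1))) = _
  rw [← map_add]
  set D : MuCarrier K n := φ.1 (σ, σ) + φ.1 (1, 1) with hD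
  have hD2 : 2 • D = 0 := by
    have h := two_nsmul_twoCocycleDiagonal (X := ((mu K n).toLocal (Sum.inl w : Place K)).toTopRep) hG
      (fun τ hτ y => toLocal_inl_rho_eq_neg K n w hτ y) φ
    rwa [twoCocycleDiagonal_of_ne_one (X := ((mu K n).toLocal (Sum.inl w : Place K)).toTopRep) hG hσ] at h
  by_cases hD0 : D = 0
  · rw [hD0, map_zero, map_zero, map_zero, ZMod.val_zero, zero_mul, Nat.cast_zero]
  obtain ⟨hDn, h2n⟩ := addEquiv_apply_eq_natCast_div_two (muCarrierZModEquiv K n) hD2 hD0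
  have hιD0 : muInclusion K hnN D ≠ 0 := by
    intro h
    apply hD0
    apply muVal_injective K n
    rw [← muVal_muInclusion K hnN D, h, muVal_zero, muVal_zero]
  have hιD2 : 2 • muInclusion K hnN D = 0 := by rw [← map_nsmul, hD2, map_zero]
  obtain ⟨hDN, -⟩ := addEquiv_apply_eq_natCast_div_two (muCarrierZModEquiv K N) hιD2 hιD0
  rw [hDN, hDn, ZMod.val_natCast, Nat.mod_eq_of_lt (Nat.div_lt_self (NeZero.pos n) one_lt_two),
    div_two_mul_div (NeZero.ne n) h2n hnN]

end ArchLevel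

/-! ## §2 The bridge `inv^{(m²)}_v(a ∪_desc b) = m · inv^{(m)}_v(a ∪_{e_D} b)` at the infinite places, hence at every place -/

section Bridge

variable {K : Type} [Field K] [NumberField K] (W : WeierstrassCurve K) (m : ℕ) [NeZero m]
variable (e : geomTorsion W ((m * m : ℕ) : ℤ) → geomTorsion W ((m * m : ℕ) : ℤ) → AlgebraicClosure K)
  (hμ : ∀ S T, e S T ^ (m * m) = 1)
  (hadd₁ : ∀ S₁ S₂ T, e (S₁ + S₂) T = e S₁ T * e S₂ T)
  (hadd₂ : ∀ S T₁ T₂, e S (T₁ + T₂) = e S T₁ * e S T₂)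
  (hgal : ∀ (σ : absoluteGaloisGroup K) (S T : geomTorsion W ((m * m : ℕ) : ℤ)), σ • e S T = e (σ • S) (σ • T))

/-- **Milne's local pairing at an INFINITE place through THE invariant maps is `m` times the level-`m` Weil pairing of
`e_D`**, at EVERY level `m`: `inv^{(m²)}_w(a ∪_desc b) = m · inv^{(m)}_w(a ∪_{e_D} b)` in `ℤ/m²` for `a, b ∈ H¹(K_w, E[m])`.
Proof: `∪_desc = H²(μ_m ⊆ μ_{m²}) ∘ ∪_{e_D}` (covariant naturality of the cup product, `ContPairing.cupProduct_map`, along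
`ι ∘ e_D = desc`) and the level compatibility of the ARCHIMEDEAN invariant map on local classes (§1).
[cite: SerreLocalFields1979, XIII §3 Cor. 3] [cite: MilneADT2006, Ch. I §6, proof of Prop. 6.9] -/
theorem descLocalPairing_canonical_inl (w : InfinitePlace K)
    (a b : galoisCohomology ((W.torsionGaloisModule (m : ℤ)).toLocal (Sum.inl w)) 1) :
    descLocalPairing W m e hμ hadd₁ hadd₂ hgal (LocalInvariants.canonical K (m * m)) (Sum.inl w) a b =
      (((invWeilPairing W m
          (fun S T => ((muVal K (m * m) (descendHom W m m e hμ hadd₁ hadd₂ S T) : (AlgebraicClosure K)ˣ) :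
            AlgebraicClosure K))
          (descFun_pow W m e hμ hadd₁ hadd₂) (descFun_add₁ W m e hμ hadd₁ hadd₂) (descFun_add₂ W m e hμ hadd₁ hadd₂)
          (descFun_smul W m e hμ hadd₁ hadd₂ hgal) (LocalInvariants.canonical K m) (Sum.inl w) a b).val * m : ℕ) :
        ZMod (m * m)) := by
  -- cup products need `LocallyCompactSpace Γ`
  haveI : CompactSpace (absoluteGaloisGroup K) := absoluteGaloisGroup_compactSpace K
  haveI : CompactSpace (absoluteGaloisGroup (Place.Completion (Sum.inl w : Place K))) := absoluteGaloisGroup_compactSpace _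
  -- the inclusion `μ_m ⊆ μ_{m²}` restricted to `Γ_{K_w}`
  let γ : ((mu K m).toLocal (Sum.inl w : Place K)).toTopRep ⟶ ((mu K (m * m)).toLocal (Sum.inl w : Place K)).toTopRep :=
    TopRep.ofHom ((muInclHom K (dvd_mul_right m m)).hom.restrict
      (absGaloisRestrict K (Place.Completion (Sum.inl w : Place K)) :
        absoluteGaloisGroup (Place.Completion (Sum.inl w : Place K)) →* absoluteGaloisGroup K))
  -- (B) the descended cup product is `H²(γ)` of the level-`m` Weil cup product of `e_D`
  have hB : ((descendPairing W m m e hμ hadd₁ hadd₂ hgal).restrict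
        (absGaloisRestrict K (Place.Completion (Sum.inl w : Place K)))).cupProduct a b =
      cohomologyMap γ 2 ((weilContPairingLocal W m
          (fun S T => ((muVal K (m * m) (descendHom W m m e hμ hadd₁ hadd₂ S T) : (AlgebraicClosure K)ˣ) :
            AlgebraicClosure K))
          (descFun_pow W m e hμ hadd₁ hadd₂) (descFun_add₁ W m e hμ hadd₁ hadd₂) (descFun_add₂ W m e hμ hadd₁ hadd₂)
          (descFun_smul W m e hμ hadd₁ hadd₂ hgal) (Sum.inl w)).cupProduct a b) := by
    have hmap := ContPairing.cupProduct_map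
      (weilContPairingLocal W m
        (fun S T => ((muVal K (m * m) (descendHom W m m e hμ hadd₁ hadd₂ S T) : (AlgebraicClosure K)ˣ) :
          AlgebraicClosure K))
        (descFun_pow W m e hμ hadd₁ hadd₂) (descFun_add₁ W m e hμ hadd₁ hadd₂) (descFun_add₂ W m e hμ hadd₁ hadd₂)
        (descFun_smul W m e hμ hadd₁ hadd₂ hgal) (Sum.inl w))
      ((descendPairing W m m e hμ hadd₁ hadd₂ hgal).restrict
        (absGaloisRestrict K (Place.Completion (Sum.inl w : Place K)))) (𝟙 _) (𝟙 _) γ (fun x y =>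
          muInclusion_weilPairingHom_descFun W m e hμ hadd₁ hadd₂ x y) a b
    have ha : cohomologyMap (𝟙 ((W.torsionGaloisModule (m : ℤ)).toLocal (Sum.inl w : Place K)).toTopRep) 1 a = a :=
      map_apply_of_id _ (fun _ => rfl) _ (fun _ => rfl) 1 a
    have hb : cohomologyMap (𝟙 ((W.torsionGaloisModule (m : ℤ)).toLocal (Sum.inl w : Place K)).toTopRep) 1 b = b :=
      map_apply_of_id _ (fun _ => rfl) _ (fun _ => rfl) 1 b
    exact (hmap.trans (congrArg₂ (fun x y => ((descendPairing W m m e hμ hadd₁ hadd₂ hgal).restrict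
        (absGaloisRestrict K (Place.Completion (Sum.inl w : Place K)))).cupProduct x y) ha hb)).symm
  -- (C) level change for THE archimedean invariant map on local classes
  have hC : ∀ c : galoisCohomology ((mu K m).toLocal (Sum.inl w : Place K)) 2,
      archimedeanInvariantMap K (m * m) w (cohomologyMap γ 2 c) =
        (((archimedeanInvariantMap K m w c).val * m : ℕ) : ZMod (m * m)) := fun c => by
    have h := archimedeanInvariantMap_cohomologyMap_muInclHom_local (K := K) (n := m) (N := m * m) w
      (dvd_mul_right m m) c
    rwa [Nat.mul_div_cancel_left m (NeZero.pos m)] at h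
  rw [descLocalPairing_apply, invWeilPairing_apply,
    LocalInvariants.canonical_inl, LocalInvariants.canonical_inl, hB, hC]

/-- **The bridge at EVERY place and EVERY level** (finite places: the tree's `descLocalPairing_canonical_inr`; infinite places:
`descLocalPairing_canonical_inl`) — the odd-level shortcut of `descLocalPairing_canonical_eq` removed.
[cite: MilneADT2006, Ch. I §6, proof of Prop. 6.9] [cite: SerreLocalFields1979, XIII §3 Cor. 3] -/
theorem descLocalPairing_canonical_place (v : Place K)
    (a b : galoisCohomology ((W.torsionGaloisModule (m : ℤ)).toLocal v) 1) :
    descLocalPairing W m e hμ hadd₁ hadd₂ hgal (LocalInvariants.canonical K (m * m)) v a b =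
      (((invWeilPairing W m
          (fun S T => ((muVal K (m * m) (descendHom W m m e hμ hadd₁ hadd₂ S T) : (AlgebraicClosure K)ˣ) :
            AlgebraicClosure K))
          (descFun_pow W m e hμ hadd₁ hadd₂) (descFun_add₁ W m e hμ hadd₁ hadd₂) (descFun_add₂ W m e hμ hadd₁ hadd₂)
          (descFun_smul W m e hμ hadd₁ hadd₂ hgal) (LocalInvariants.canonical K m) v a b).val * m : ℕ) :
        ZMod (m * m)) := by
  rcases v with w | v
  · exact descLocalPairing_canonical_inl W m e hμ hadd₁ hadd₂ hgal w a b
  · exact descLocalPairing_canonical_inr W m e hμ hadd₁ hadd₂ hgal v a b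

end Bridge

/-! ## §3 Milne I Lemma 6.15 for THE invariant maps at EVERY prime-power level -/

section Main

variable {K : Type} [Field K] [NumberField K] (W : WeierstrassCurve K) [W.IsElliptic] (p k : ℕ) [Fact p.Prime]
variable (e : geomTorsion W ((p ^ k * p ^ k : ℕ) : ℤ) → geomTorsion W ((p ^ k * p ^ k : ℕ) : ℤ) → AlgebraicClosure K)
  (hμ : ∀ S T, e S T ^ (p ^ k * p ^ k) = 1)
  (hadd₁ : ∀ S₁ S₂ T, e (S₁ + S₂) T = e S₁ T * e S₂ T)
  (hadd₂ : ∀ S T₁ T₂, e S (T₁ + T₂) = e S T₁ * e S T₂)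
  (hgal : ∀ (σ : absoluteGaloisGroup K) (S T : geomTorsion W ((p ^ k * p ^ k : ℕ) : ℤ)), σ • e S T = e (σ • S) (σ • T))
  (halt : ∀ T, e T T = 1) (hnd : ∀ T, (∀ S, e S T = 1) → T = 0)

include halt hnd in
/-- **The Lemma-6.15 input of the Cassels–Tate recipe FOR THE INVARIANT MAPS `LocalInvariants.canonical K (m·m)` at EVERY
prime-power level `m = p^k` (`k ≥ 1`, ANY prime `p` — in particular `p = 2`), one elliptic curve `E/K` over any number field
and EVERY finite set of places `S`, from Poitou–Tate duality AT THE ONE MODULE `E[m]` in Howard's Thm. 2.1.11 (i) shape for THE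
maps at level `m` (`hSC`).** If `x ∈ X_S = ∏_{v∈S} H¹(K_v, E[m])` annihilates the localisations of `Sel^{(m)}(E/K)` under
Milne's sum pairing `∑_{v∈S} inv^{(m²)}_v(· ∪_desc ·)`, then `x ≡ loc_S b₀` modulo the local Kummer conditions for some
`b₀ ∈ H¹(K, E[m])` with the Kummer condition off `S`. The SOED theorem `lemma615Input_canonical_of_selmerComplementAt`
WITHOUT `p ≠ 2`: the bridge at every place is `descLocalPairing_canonical_place`; the test classes are Kummer at a real place by
the injectivity of THE archimedean invariant map (`LocalInvariants.canonical_injectiveAtRealPlaces`) and vanish at a complex one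
(`galoisCohomology_one_torsion_eq_zero_infinitePlace_of_isComplex`).
[cite: MilneADT2006, Ch. I, Lemma 6.15] [cite: Howard2004HeegnerKolyvagin, Thm. 2.1.11] [cite: GreenbergLNM1716, §4 App., Prop. 4.13] -/
theorem lemma615Input_canonical_of_selmerComplementAt_anyLevel [NeZero (p ^ k)] [Finite (W.geomTorsion ((p ^ k : ℕ) : ℤ))]
    (hk : 0 < k)
    (hSC : ∀ (S : Finset (Place K)),
      (∀ v : HeightOneSpectrum (𝓞 K), (Sum.inr v : Place K) ∉ S →
        ((p ^ k : ℕ) : 𝓞 K) ∉ v.asIdeal ∧ GaloisRep.IsUnramifiedAt v (W.torsionGaloisModule ((p ^ k : ℕ) : ℤ))) →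
      ∀ (𝓕 𝓖 : SelmerStructure (W.torsionGaloisModule ((p ^ k : ℕ) : ℤ))), 𝓕 ≤ 𝓖 →
        𝓕.IsUnramifiedOutside S → 𝓖.IsUnramifiedOutside S →
        ∀ t : Π v : Place K, galoisCohomology ((W.torsionGaloisModule ((p ^ k : ℕ) : ℤ)).toLocal v) 1,
          (∀ v ∈ S, t v ∈ 𝓖 v) →
          (∀ y ∈ ((LocalInvariants.canonical K (p ^ k)).dualSelmerStructure
              (W.torsionGaloisModule ((p ^ k : ℕ) : ℤ)) 𝓕).selmerGroup,
            ∑ v ∈ S, localTatePairingZMod (W.torsionGaloisModule ((p ^ k : ℕ) : ℤ)) (p ^ k) v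
              (LocalInvariants.canonical K (p ^ k) v) (t v)
              (galoisCohomology.localization ((W.torsionGaloisModule ((p ^ k : ℕ) : ℤ)).tateDual (p ^ k)) v 1 y) = 0) →
          ∃ x ∈ 𝓖.selmerGroup, ∀ v ∈ S,
            galoisCohomology.localization (W.torsionGaloisModule ((p ^ k : ℕ) : ℤ)) v 1 x - t v ∈ 𝓕 v)
    (S : Finset (Place K)) (x : LocalClasses W (p ^ k) S)
    (hx : ∀ b' ∈ W.selmerGroup ((p ^ k : ℕ) : ℤ),
      sumPairing W (p ^ k) e hμ hadd₁ hadd₂ hgal (LocalInvariants.canonical K (p ^ k * p ^ k)) S x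
        (locS W (p ^ k) S b') = 0) :
    ∃ b₀ ∈ kummerOutside W (p ^ k) S, ∀ v : S,
      x v - locS W (p ^ k) S b₀ v ∈ W.kummerLocalConditionAt ((p ^ k : ℕ) : ℤ) (Place.Completion (v : Place K)) := by
  classical
  -- the test family, extended by zero off `S`
  let t : Π v : Place K, galoisCohomology ((W.torsionGaloisModule ((p ^ k : ℕ) : ℤ)).toLocal v) 1 :=
    fun v => if h : v ∈ S then x ⟨v, h⟩ else 0
  have ht : ∀ v : S, t v = x v := fun v => by
    show (if h : (v : Place K) ∈ S then x ⟨v, h⟩ else 0) = x v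
    rw [dif_pos v.2]
  -- tp2-p3-w3 g6's per-module theorem at level `m = p^k`, Weil-type pairing `e_D`, THE maps
  have hinj : ∀ v : HeightOneSpectrum (𝓞 K), Injective (LocalInvariants.canonical K (p ^ k) (Sum.inr v)) := fun v => by
    rw [LocalInvariants.canonical_inr]; exact (localInvariantMap_bijective v).1
  have key := SignedEC.CasselsPT.exists_mem_kummerOutside_localization_sub_mem_of_selmerComplementAt W p k
    (fun S T => ((muVal K (p ^ k * p ^ k) (descendHom W (p ^ k) (p ^ k) e hμ hadd₁ hadd₂ S T) : (AlgebraicClosure K)ˣ) :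
      AlgebraicClosure K))
    (descFun_pow W (p ^ k) e hμ hadd₁ hadd₂) (descFun_add₁ W (p ^ k) e hμ hadd₁ hadd₂) (descFun_add₂ W (p ^ k) e hμ hadd₁ hadd₂)
    (descFun_smul W (p ^ k) e hμ hadd₁ hadd₂ hgal) (descFun_self W (p ^ k) e hμ hadd₁ hadd₂ halt)
    (descFun_nondeg W (p ^ k) e hμ hadd₁ hadd₂ hnd) hk hinj hSC S t
  obtain ⟨x', hx', hx't⟩ := key (fun c hcfin hcinf => by
      -- the test class is a Selmer class: Kummer at the finite places by hypothesis, at a real place by the injectivity of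
      -- THE archimedean invariant map there, and zero at a complex place
      have hcSel : c ∈ W.selmerGroup ((p ^ k : ℕ) : ℤ) := by
        refine (mem_selmerGroup_iff_forall_localization_mem W _ c).mpr ?_
        rintro (w | v)
        · rcases w.isReal_or_isComplex with hw | hw
          · exact hcinf w (LocalInvariants.canonical_injectiveAtRealPlaces w hw)
          · rw [galoisCohomology_one_torsion_eq_zero_infinitePlace_of_isComplex W w hw
              (galoisCohomology.localization (W.torsionGaloisModule ((p ^ k : ℕ) : ℤ)) (Sum.inl w) 1 c)]
            exact zero_mem _
        · exact hcfin v
      -- Milne's orthogonality at level `m²`, rewritten through the bridge at every place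
      have h0 := hx c hcSel
      rw [sumPairing_apply] at h0
      have h1 : ∑ v ∈ S, (((invWeilPairing W (p ^ k)
          (fun S T => ((muVal K (p ^ k * p ^ k) (descendHom W (p ^ k) (p ^ k) e hμ hadd₁ hadd₂ S T) :
            (AlgebraicClosure K)ˣ) : AlgebraicClosure K))
          (descFun_pow W (p ^ k) e hμ hadd₁ hadd₂) (descFun_add₁ W (p ^ k) e hμ hadd₁ hadd₂)
          (descFun_add₂ W (p ^ k) e hμ hadd₁ hadd₂) (descFun_smul W (p ^ k) e hμ hadd₁ hadd₂ hgal)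
          (LocalInvariants.canonical K (p ^ k)) v (t v)
          (galoisCohomology.localization (W.torsionGaloisModule ((p ^ k : ℕ) : ℤ)) v 1 c)).val * p ^ k : ℕ) :
            ZMod (p ^ k * p ^ k)) = 0 := by
        rw [← h0, ← Finset.sum_coe_sort S]
        refine Finset.sum_congr rfl fun v _ => ?_
        rw [← descLocalPairing_canonical_place W (p ^ k) e hμ hadd₁ hadd₂ hgal, ht v]
        rfl
      rw [← natCast_val_mul_sum] at h1
      exact eq_zero_of_natCast_val_mul_eq_zero (p ^ k) _ h1)
  refine ⟨x', hx', fun v => ?_⟩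
  have h := hx't (v : Place K) v.2
  rw [kummerSelmerStructure_apply, ht v] at h
  have h' := neg_mem h
  rwa [neg_sub] at h'

include halt hnd in
/-- **Milne I Lemma 6.15 for THE invariant maps, UNCONDITIONALLY, at EVERY prime-power level** `m = p^k` (`k ≥ 1`, any prime
`p`, any number field `K`, any elliptic `E/K`, every finite `S`): the `h615` body of the tree's
`isLevelPairing_ctLevelPairing_of_inputs` / `casselsTate_levelInputs_of_canonical_inputs` for `LocalInvariants.canonical K (m·m)`,
its per-module Poitou–Tate binder `hSC` supplied by Howard's complement property of THE canonical family at every level — the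
tree theorem `SchneiderFreeAdditiveX3.PoitouTateReduction.selmerComplement_canonical_holds` (Milne I 4.10 (b) for THE maps, cell
bsd-schneider). At `p = 2` this is the `h615` input of `hB₁`/`hB₂` of the LINE 6/13 capstones.
[cite: MilneADT2006, Ch. I, Thm. 4.10 (b), Lemma 6.15] [cite: Howard2004HeegnerKolyvagin, Thm. 2.1.11 (arXiv:1202.6340 p. 6)] -/
theorem lemma615Input_canonical [NeZero (p ^ k)] [Finite (W.geomTorsion ((p ^ k : ℕ) : ℤ))] (hk : 0 < k)
    (S : Finset (Place K)) (x : LocalClasses W (p ^ k) S)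
    (hx : ∀ b' ∈ W.selmerGroup ((p ^ k : ℕ) : ℤ),
      sumPairing W (p ^ k) e hμ hadd₁ hadd₂ hgal (LocalInvariants.canonical K (p ^ k * p ^ k)) S x
        (locS W (p ^ k) S b') = 0) :
    ∃ b₀ ∈ kummerOutside W (p ^ k) S, ∀ v : S,
      x v - locS W (p ^ k) S b₀ v ∈ W.kummerLocalConditionAt ((p ^ k : ℕ) : ℤ) (Place.Completion (v : Place K)) :=
  lemma615Input_canonical_of_selmerComplementAt_anyLevel W p k e hμ hadd₁ hadd₂ hgal halt hnd hk
    (fun S hS 𝓕 𝓖 hle h𝓕 h𝓖 t ht horth =>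
      (SchneiderFreeAdditiveX3.PoitouTateReduction.selmerComplement_canonical_holds (K := K) (p ^ k)
        (W.torsionGaloisModule ((p ^ k : ℕ) : ℤ))
        (fun P => Subtype.ext (by
          have h := (mem_geomTorsion_iff W ((p ^ k : ℕ) : ℤ) (P : geomPoints W)).mp P.2
          rw [natCast_zsmul] at h
          exact h))
        S hS 𝓕 𝓖 hle h𝓕 h𝓖).1 t ht horth)
    S x hx

end Main



end Summit.BirchSwinnertonDyer.BirchSwinnertonDyer.Theorems.GenusExact.CasselsTateAnyLevel

end
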